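import Summits.BirchSwinnertonDyer.BirchSwinnertonDyer.Theorems.GenusKolyvaginAtTwoPowDvdShaCardAtTwoRTRungFamilies
import HarnessLib

/-!
# Route `GenusKolyvaginAtTwo`, LINE 18 (L_T `PowDvdShaCardAtTwoRT`, stmt-BirchSwinnertonDyer-23242), stub L
# `stub_twinShaLaddersAtTwo` — THE DESCENT LAYER FOR THE OTHER ROOT NUMBER: the twin rank `0`, `W` of rank `1`

Seat `bsd-line-gk2-p2` g18 (PROVER seat 2/3, cell `bsd-f1-sign2`), `--supports stmt-BirchSwinnertonDyer-23242` (helper; closes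
nothing). THEOREMS ONLY (no definition, no named fact, no `sorry`); BSD is not proved by any of this.

WHY. `…RTRungFamilies` / `…RTTwinShaLaddersOfSupplies` wire the descent for the configuration `w(E) = +1` (the Heegner point
`y_K` is `τ`-ANTI-fixed, `E(ℚ)` has rank `0`, the twin rank `1`: injective Kummer map on the `W` side, seed `⟨δ(P₁)⟩` on the twin
side). L_T's frame does not fix the root number; for `w(E) = −1` (`y_K ∈ E(ℚ)`, `E` of rank `1`, the twin of rank `0`) the SAME
ladder shape of stub L is met by INTERLEAVING Kolyvagin's minima by sign (`M(2m) − M(2m+1)` := the fixed drop at depth `2m+2`,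
`M(2m+1) − M(2m+2)` := the anti-fixed drop at depth `2m+1`; McCallum's family sizes are `r+1 = 2m+2` on the rank-`0` side and
`r = 2m+2` on the Mordell–Weil side in both configurations), and the descent needs the roles swapped: the SEED on the `W` side, the
INJECTIVE Kummer map on the twin side. This file supplies those two variants and the corresponding top-level statement.

* §1 `exists_galH1Family_twist_of_conjAct_eq_neg_of_injective`, **`exists_shaFamily_twin_of_antifixed_selmerFamily_of_divisible`** —
  (−) side with NO condition over `K` when `Wd(ℚ)` is `n`-divisible (rank `0`, odd torsion); injectivity of `H¹(ℚ, Wd[n]) → H¹(ℚ, Wd)`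
  is moved to the model `W^{(d_K)}` along `Cd` (`torsionH1ToH1_h1TorsionIso`).
* §2 **`exists_shaFamily_W_of_forall_exists_avoiding_seed`** — (+) side from McCallum-shaped avoidance WITH the seed `⟨δ(P₀)⟩`
  (`P₀ = y_K ∈ E(ℚ) ⊆ E(K)`), via `…RTRungDescentKummer`; **`exists_shaFamily_twin_of_forall_exists_avoiding_of_divisible`** — (−) side
  from plain avoidance.
* §3 **`twinShaLadders_of_Kside_supplies_swapped`** — stub L's conclusion VERBATIM from K-side supplies in the `w(E) = −1`
  configuration.

References: [McCallumLMS1991] §5 Prop. 5.2, Thm. 5.4 (p. 310); [GrossLMS1991] §5 (5.1), Prop. 5.3–5.4; [Kolyvagin1991MathAnn] Thm. 1.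
-/

set_option autoImplicit false
-- the Theorems namespace of this sub repeats the summit name by design (D-0017 nested layout)
set_option linter.dupNamespace false

noncomputable section

open scoped Classical

namespace Summit.BirchSwinnertonDyer.BirchSwinnertonDyer.Theorems.GenusExact.PlusDescent

open WeierstrassCurve NumberField Field Literature.NumberTheory.EllipticCurves
  Literature.NumberTheory.GaloisRepresentations Literature.NumberTheory.QuadraticFields AddSubgroup

/-! ## §1 The (−) side with an injective Kummer map on the twin -/

section AntiFixedInjective

variable (W : WeierstrassCurve ℚ) (K : Type) [Field K] [NumberField K]
  (h2 : Module.finrank ℚ K = 2) {θ : K} {c : ℚ} (hθ : θ ∉ Set.range (algebraMap ℚ K))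
  (hc : θ ^ 2 = algebraMap ℚ K c) (n : ℤ)

/-- **Descent of a `τ`-anti-fixed family to the twist, Kummer condition over `ℚ`.** As `exists_galH1Family_twist_of_conjAct_eq_neg`,
with the span condition over `K` replaced by the injectivity of `H¹(ℚ, E^{(c)}[n]) → H¹(ℚ, E^{(c)})` (the twist of rank `0` with
torsion prime to `n`). [cite: GrossLMS1991, §5 (5.1)] [cite: McCallumLMS1991, §5 Thm. 5.4] -/
theorem exists_galH1Family_twist_of_conjAct_eq_neg_of_injective
    (hL : ∀ P : (W.baseChange K).toAffine.Point, n • P = 0 → P = 0)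
    (hinjQ : Function.Injective (torsionH1ToH1 (W.quadraticTwist c) n))
    {s : ℕ} (z : Fin s → galH1Torsion (W.baseChange K) n)
    (hanti : ∀ i, conjAct W (sigmaQ K h2 hθ hc) n (z i) = -z i) :
    ∃ x' : Fin s → (W.quadraticTwist c).galH1,
      (∀ i, resBaseChange (W.quadraticTwist c) K (x' i) =
        torsionH1ToH1 ((W.quadraticTwist c).baseChange K) n ((hPsiKT W K hθ hc n).symm (z i))) ∧
      ∀ e : Fin s → ℤ, ∑ i, e i • x' i = 0 ↔ ∑ i, e i • z i = 0 := by
  have hdesc : ∀ i, ∃ xt : galH1Torsion (W.quadraticTwist c) n,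
      hPsiKT W K hθ hc n (resTorsion (W.quadraticTwist c) K n xt) = z i := fun i ↦
    (EigenClassesFinite.existsUnique_hPsiKT_resTorsion_eq_of_conjAct_eq_neg W K h2 hθ hc n hL (hanti i)).exists
  choose xt hxt using hdesc
  have hxt' : ∀ i, resTorsion (W.quadraticTwist c) K n (xt i) = (hPsiKT W K hθ hc n).symm (z i) := fun i ↦ by
    rw [← hxt i, AddEquiv.symm_apply_apply]
  have hinjres := EigenClassesFinite.resTorsion_twist_injective_of_noTorsion W K h2 hθ hc n hL
  -- the composite `hPsiKT ∘ res` is injective, so relations of `xt` are those of `z`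
  set F : galH1Torsion (W.quadraticTwist c) n →+ galH1Torsion (W.baseChange K) n :=
    (hPsiKT W K hθ hc n).toAddMonoidHom.comp (resTorsion (W.quadraticTwist c) K n) with hF
  have hFx : ∀ i, F (xt i) = z i := fun i ↦ by rw [hF, AddMonoidHom.comp_apply, AddEquiv.coe_toAddMonoidHom, hxt]
  have hz : ∀ e : Fin s → ℤ, ∑ i, e i • z i = 0 ↔ ∑ i, e i • xt i = 0 := fun e ↦ by
    have h := sum_zsmul_map_eq_zero_iff_of_injOn_span F xt (fun e' he' ↦ by
      rw [hF, AddMonoidHom.comp_apply, AddEquiv.coe_toAddMonoidHom, map_eq_zero_iff _ (hPsiKT W K hθ hc n).injective] at he'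
      exact hinjres (by rw [he', map_zero])) e
    simpa only [hFx] using h
  refine ⟨fun i ↦ torsionH1ToH1 (W.quadraticTwist c) n (xt i), fun i ↦ ?_, fun e ↦ ?_⟩
  · rw [← torsionH1ToH1_resTorsion, hxt']
  · rw [hz]
    exact sum_zsmul_map_eq_zero_iff_of_injOn_span (torsionH1ToH1 (W.quadraticTwist c) n) xt
      (fun e' he' ↦ hinjQ (by rw [he', map_zero])) e

end AntiFixedInjective

section RungTwinInjective

variable (W : WeierstrassCurve ℚ) (K : Type) [Field K] [NumberField K]
  (h2 : Module.finrank ℚ K = 2) (σ : K ≃ₐ[ℚ] K) (hσ : σ ≠ 1) (n : ℤ)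

include h2 hσ in
/-- **ONE RUNG OF L's `Wd`-LADDER, the twin of rank `0`** (`w(E) = −1`): `K` quadratic, `σ ≠ 1`, `n ≠ 0`, `E(K)[n] = 0`, `Wd` an
elliptic ℚ-model of `W^{(d_K)}` with `Wd(ℚ)` `n`-divisible (rank `0`, torsion prime to `n`); `z : Fin s → H¹(K, E_K[n])` SELMER,
`σ z_i = −z_i`, of order `2^a`, independent modulo `2^a` — NO condition on the span over `K`. Then `∃ y : Fin s → H¹(ℚ, Wd)` with
`res_K y_i ∈ Ш(Wd_K/K)`, `ord y_i = 2^a`, independent modulo `2^a`. [cite: McCallumLMS1991, §5 Thm. 5.4 (p. 310)] [cite: GrossLMS1991, §5 (5.1)] -/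
theorem exists_shaFamily_twin_of_antifixed_selmerFamily_of_divisible (hn : n ≠ 0)
    (hL : ∀ P : (W.baseChange K).toAffine.Point, n • P = 0 → P = 0)
    {Wd : WeierstrassCurve ℚ} [Wd.IsElliptic] (hWd : ∃ C : VariableChange ℚ, C • W.quadraticTwist (NumberField.discr K : ℚ) = Wd)
    (hdivWd : ∀ P : Wd.toAffine.Point, ∃ Q : Wd.toAffine.Point, n • Q = P)
    {s a : ℕ} (z : Fin s → galH1Torsion (W.baseChange K) n)
    (hsel : ∀ i, z i ∈ selmerGroup (W.baseChange K) n)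
    (hanti : ∀ i, conjAct W σ n (z i) = -z i)
    (hord : ∀ i, addOrderOf (z i) = 2 ^ a)
    (hind : ∀ e : Fin s → ℤ, ∑ i, e i • z i = 0 → ∀ i, ((2 ^ a : ℕ) : ℤ) ∣ e i) :
    ∃ y : Fin s → Wd.galH1, (∀ i, resBaseChange Wd K (y i) ∈ (Wd.baseChange K).sha) ∧
      (∀ i, addOrderOf (y i) = 2 ^ a) ∧
      ∀ e : Fin s → ℤ, ∑ i, e i • y i = 0 → ∀ i, ((2 ^ a : ℕ) : ℤ) ∣ e i := by
  obtain ⟨τ, θ₀, hτ, hθ₀, hsq, -, hall⟩ := exists_gal_ne_one_sqrt_discr (K := K) h2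
  have hστ : σ = sigmaQ K h2 hθ₀ hsq := eq_sigmaQ_of_ne_one K h2 σ hσ hθ₀ hsq
  subst hστ
  -- injectivity on `Wd`, moved to the model `W^{(d_K)}` along `Cd`
  have hinjWd : Function.Injective (torsionH1ToH1 Wd n) := torsionH1ToH1_injective_of_divisible Wd hn (by convert hdivWd)
  obtain ⟨Cd, rfl⟩ := hWd
  have hinjQ : Function.Injective (torsionH1ToH1 (W.quadraticTwist (NumberField.discr K : ℚ)) n) := by
    refine (injective_iff_map_eq_zero _).mpr fun s hs ↦ ?_
    have h := torsionH1ToH1_h1TorsionIso n (rfl : Cd • W.quadraticTwist (NumberField.discr K : ℚ) = _) s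
    rw [hs, map_zero] at h
    exact (map_eq_zero_iff _ (AddEquiv.injective _)).mp ((injective_iff_map_eq_zero _).mp hinjWd _ h)
  obtain ⟨x', hres, hrel⟩ :=
    exists_galH1Family_twist_of_conjAct_eq_neg_of_injective W K h2 hθ₀ hsq n hL hinjQ z hanti
  refine ⟨fun i ↦ galH1Equiv (W.quadraticTwist (NumberField.discr K : ℚ)) Cd (x' i), fun i ↦ ?_, fun i ↦ ?_, ?_⟩
  · rw [resBaseChange_galH1Equiv_mem_sha_iff, hres i]
    have hz' : (hPsiKT W K hθ₀ hsq n).symm (z i) ∈ selmerGroup ((W.quadraticTwist (NumberField.discr K : ℚ)).baseChange K) n := by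
      rw [mem_selmerGroup_iff_hPsiKT_mem W K hθ₀ hsq n, AddEquiv.apply_symm_apply]
      exact hsel i
    rw [selmerGroup_eq_comap_sha, AddSubgroup.mem_comap] at hz'
    exact hz'
  · rw [AddEquiv.addOrderOf_eq, addOrderOf_eq_of_forall_sum_zsmul_eq_zero_iff x' z hrel i, hord i]
  · set G := galH1Equiv (W.quadraticTwist (NumberField.discr K : ℚ)) Cd with hG
    have hrel' : ∀ e : Fin s → ℤ, ∑ i, e i • G (x' i) = 0 ↔ ∑ i, e i • z i = 0 := fun e ↦ by
      rw [← hrel e]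
      have h := sum_zsmul_map_eq_zero_iff_of_injOn_span G.toAddMonoidHom x'
        (fun e' he' ↦ G.injective (by rw [map_zero]; exact he')) e
      simpa only [AddEquiv.coe_toAddMonoidHom] using h
    exact indep_of_forall_sum_zsmul_eq_zero_iff _ z hrel' hind

end RungTwinInjective

/-! ## §2 From McCallum-shaped avoidance, roles swapped: seed on `W`, plain avoidance on the twin -/

section Swapped

variable (W : WeierstrassCurve ℚ) (K : Type) [Field K] [NumberField K]
  (h2 : Module.finrank ℚ K = 2) (σ : K ≃ₐ[ℚ] K) (hσ : σ ≠ 1) (L : ℕ)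

include h2 hσ in
/-- **A RUNG OF L's `W`-LADDER WITH THE SEED `⟨δ(P₀)⟩`** (`w(E) = −1`: `W` of rank `1`, `P₀ = y_K ∈ E(ℚ) ⊆ E(K)`, `2^L ∤ P₀`, `g` a
generator of `E(K)` modulo `2^L`, `E(K)[2^L] = 0`): if for every `i < s` and every `i` FIXED Selmer classes `u_k` of order `2^a` some
fixed Selmer class of order `2^a` avoids `⟨u⟩ + ⟨δ(P₀)⟩`, then L's `hfam` rung holds. [cite: McCallumLMS1991, §5 Prop. 5.2, Thm. 5.4 (p. 310)] -/
theorem exists_shaFamily_W_of_forall_exists_avoiding_seed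
    (hdiv : ∀ P : geomPoints (W.baseChange K), ∃ Q : geomPoints (W.baseChange K), ((2 ^ L : ℕ) : ℤ) • Q = P)
    (hL : ∀ P : (W.baseChange K).toAffine.Point, ((2 ^ L : ℕ) : ℤ) • P = 0 → P = 0)
    (g : (W.baseChange K).toAffine.Point)
    (hg : ∀ P : (W.baseChange K).toAffine.Point, ∃ (k : ℤ) (Q : (W.baseChange K).toAffine.Point),
      ((2 ^ L : ℕ) : ℤ) • Q = P - k • g)
    (P₀ : (W.baseChange K).toAffine.Point) (hP₀ : ∀ Q : (W.baseChange K).toAffine.Point, ((2 ^ L : ℕ) : ℤ) • Q ≠ P₀)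
    {s a : ℕ}
    (havoid : ∀ i < s, ∀ u : Fin i → galH1Torsion (W.baseChange K) ((2 ^ L : ℕ) : ℤ),
      (∀ k, u k ∈ selmerGroup (W.baseChange K) ((2 ^ L : ℕ) : ℤ) ∧ conjAct W σ ((2 ^ L : ℕ) : ℤ) (u k) = u k) →
      (∀ k, addOrderOf (u k) = 2 ^ a) →
      ∃ y : galH1Torsion (W.baseChange K) ((2 ^ L : ℕ) : ℤ),
        (y ∈ selmerGroup (W.baseChange K) ((2 ^ L : ℕ) : ℤ) ∧ conjAct W σ ((2 ^ L : ℕ) : ℤ) y = y) ∧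
        addOrderOf y = 2 ^ a ∧
        Disjoint (zmultiples y) (AddSubgroup.closure (Set.range u) ⊔
          zmultiples (kummerMapTorsion (W.baseChange K) ((2 ^ L : ℕ) : ℤ) hdiv P₀))) :
    ∃ x : Fin s → W.galH1, (∀ i, resBaseChange W K (x i) ∈ (W.baseChange K).sha) ∧
      (∀ i, addOrderOf (x i) = 2 ^ a) ∧
      ∀ e : Fin s → ℤ, ∑ i, e i • x i = 0 → ∀ i, ((2 ^ a : ℕ) : ℤ) ∣ e i := by
  set C₀ : AddSubgroup (galH1Torsion (W.baseChange K) ((2 ^ L : ℕ) : ℤ)) :=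
    zmultiples (kummerMapTorsion (W.baseChange K) ((2 ^ L : ℕ) : ℤ) hdiv P₀) with hC₀
  obtain ⟨z, hP, hord, hind⟩ := exists_indepFamilyMod_of_forall_exists_avoiding (N := 2 ^ a) (s := s)
    (fun y : galH1Torsion (W.baseChange K) ((2 ^ L : ℕ) : ℤ) ↦
      y ∈ selmerGroup (W.baseChange K) ((2 ^ L : ℕ) : ℤ) ∧ conjAct W σ ((2 ^ L : ℕ) : ℤ) y = y) C₀
    (fun i hi u hPu hordu _ ↦ by
      obtain ⟨y, hPy, hy, hdisj⟩ := havoid i hi u hPu hordu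
      exact ⟨y, hPy, hy, dvd_of_zsmul_add_sum_mem_of_disjoint C₀ u hy hdisj⟩)
  have hdisj : Disjoint (AddSubgroup.closure (Set.range z)) C₀ := disjoint_closure_range_of_indepMod C₀ z hord hind
  have hker := sum_zsmul_eq_zero_of_torsionH1ToH1_eq_zero_of_disjoint_kummer (W.baseChange K) hdiv g hg P₀ hP₀ z hdisj
  exact exists_shaFamily_of_fixed_selmerFamily W K h2 σ hσ _ hL z (fun i ↦ (hP i).1) (fun i ↦ (hP i).2) hker hord
    (indep_of_indepMod C₀ z (by exact_mod_cast hind))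

include h2 hσ in
/-- **A RUNG OF L's `Wd`-LADDER, the twin of rank `0`, FROM PLAIN AVOIDANCE** (`w(E) = −1`): `Wd` an elliptic ℚ-model of `W^{(d_K)}`
with `Wd(ℚ)` `2^L`-divisible, `E(K)[2^L] = 0`; avoidance among anti-fixed Selmer classes ⟹ L's `hfam'` rung.
[cite: McCallumLMS1991, §5 Prop. 5.2, Thm. 5.4 (p. 310)] -/
theorem exists_shaFamily_twin_of_forall_exists_avoiding_of_divisible
    (hL : ∀ P : (W.baseChange K).toAffine.Point, ((2 ^ L : ℕ) : ℤ) • P = 0 → P = 0)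
    {Wd : WeierstrassCurve ℚ} [Wd.IsElliptic] (hWd : ∃ C : VariableChange ℚ, C • W.quadraticTwist (NumberField.discr K : ℚ) = Wd)
    (hdivWd : ∀ P : Wd.toAffine.Point, ∃ Q : Wd.toAffine.Point, ((2 ^ L : ℕ) : ℤ) • Q = P)
    {s a : ℕ}
    (havoid : ∀ i < s, ∀ u : Fin i → galH1Torsion (W.baseChange K) ((2 ^ L : ℕ) : ℤ),
      (∀ k, u k ∈ selmerGroup (W.baseChange K) ((2 ^ L : ℕ) : ℤ) ∧ conjAct W σ ((2 ^ L : ℕ) : ℤ) (u k) = -u k) →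
      (∀ k, addOrderOf (u k) = 2 ^ a) →
      ∃ y : galH1Torsion (W.baseChange K) ((2 ^ L : ℕ) : ℤ),
        (y ∈ selmerGroup (W.baseChange K) ((2 ^ L : ℕ) : ℤ) ∧ conjAct W σ ((2 ^ L : ℕ) : ℤ) y = -y) ∧
        addOrderOf y = 2 ^ a ∧ Disjoint (zmultiples y) (AddSubgroup.closure (Set.range u))) :
    ∃ y : Fin s → Wd.galH1, (∀ i, resBaseChange Wd K (y i) ∈ (Wd.baseChange K).sha) ∧
      (∀ i, addOrderOf (y i) = 2 ^ a) ∧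
      ∀ e : Fin s → ℤ, ∑ i, e i • y i = 0 → ∀ i, ((2 ^ a : ℕ) : ℤ) ∣ e i := by
  have hn : ((2 ^ L : ℕ) : ℤ) ≠ 0 := by positivity
  obtain ⟨z, hP, hord, hind⟩ := exists_indepFamilyMod_of_forall_exists_avoiding (N := 2 ^ a) (s := s)
    (fun y : galH1Torsion (W.baseChange K) ((2 ^ L : ℕ) : ℤ) ↦
      y ∈ selmerGroup (W.baseChange K) ((2 ^ L : ℕ) : ℤ) ∧ conjAct W σ ((2 ^ L : ℕ) : ℤ) y = -y) ⊥
    (fun i hi u hPu hordu _ ↦ by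
      obtain ⟨y, hPy, hy, hdisj⟩ := havoid i hi u hPu hordu
      exact ⟨y, hPy, hy, dvd_of_zsmul_add_sum_mem_of_disjoint ⊥ u hy (by rwa [sup_bot_eq])⟩)
  exact exists_shaFamily_twin_of_antifixed_selmerFamily_of_divisible W K h2 σ hσ _ hn hL hWd hdivWd z (fun i ↦ (hP i).1)
    (fun i ↦ (hP i).2) hord (indep_of_indepMod ⊥ z (by exact_mod_cast hind))

/-! ## §3 Stub L's conclusion in the swapped configuration -/

include h2 hσ in
/-- **STUB L's CONCLUSION FROM K-SIDE SUPPLIES, `w(E) = −1` CONFIGURATION** (`W` of rank `1` carrying `P₀ = y_K`, the twin `Wd` of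
rank `0`): a ladder `M` (antitone, `M 0 = M₀`, `M (2T) = 0` — the INTERLEAVED minima), fixed-side supplies WITH the seed `⟨δ(P₀)⟩`,
anti-fixed-side supplies plain ⟹ the conclusion of `stub_twinShaLaddersAtTwo` verbatim. [cite: McCallumLMS1991, §5 Prop. 5.2, Thm. 5.4 (p. 310)]
[cite: GrossLMS1991, §5 (5.1), Prop. 5.4] -/
theorem twinShaLadders_of_Kside_supplies_swapped
    (hdiv : ∀ P : geomPoints (W.baseChange K), ∃ Q : geomPoints (W.baseChange K), ((2 ^ L : ℕ) : ℤ) • Q = P)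
    (hL : ∀ P : (W.baseChange K).toAffine.Point, ((2 ^ L : ℕ) : ℤ) • P = 0 → P = 0)
    {Wd : WeierstrassCurve ℚ} [Wd.IsElliptic] (hWd : ∃ C : VariableChange ℚ, C • W.quadraticTwist (NumberField.discr K : ℚ) = Wd)
    (hdivWd : ∀ P : Wd.toAffine.Point, ∃ Q : Wd.toAffine.Point, ((2 ^ L : ℕ) : ℤ) • Q = P)
    (g : (W.baseChange K).toAffine.Point)
    (hg : ∀ P : (W.baseChange K).toAffine.Point, ∃ (k : ℤ) (Q : (W.baseChange K).toAffine.Point),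
      ((2 ^ L : ℕ) : ℤ) • Q = P - k • g)
    (P₀ : (W.baseChange K).toAffine.Point) (hP₀ : ∀ Q : (W.baseChange K).toAffine.Point, ((2 ^ L : ℕ) : ℤ) • Q ≠ P₀)
    (M₀ T : ℕ) (M : ℕ → ℕ) (hM : ∀ j, M (j + 1) ≤ M j) (hM0 : M 0 = M₀) (hMT : M (2 * T) = 0)
    (hsup : ∀ m < T, ∀ i < 2 * m + 2, ∀ u : Fin i → galH1Torsion (W.baseChange K) ((2 ^ L : ℕ) : ℤ),
      (∀ k, u k ∈ selmerGroup (W.baseChange K) ((2 ^ L : ℕ) : ℤ) ∧ conjAct W σ ((2 ^ L : ℕ) : ℤ) (u k) = u k) →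
      (∀ k, addOrderOf (u k) = 2 ^ (M (2 * m) - M (2 * m + 1))) →
      ∃ y : galH1Torsion (W.baseChange K) ((2 ^ L : ℕ) : ℤ),
        (y ∈ selmerGroup (W.baseChange K) ((2 ^ L : ℕ) : ℤ) ∧ conjAct W σ ((2 ^ L : ℕ) : ℤ) y = y) ∧
        addOrderOf y = 2 ^ (M (2 * m) - M (2 * m + 1)) ∧
        Disjoint (zmultiples y) (AddSubgroup.closure (Set.range u) ⊔
          zmultiples (kummerMapTorsion (W.baseChange K) ((2 ^ L : ℕ) : ℤ) hdiv P₀)))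
    (hsup' : ∀ m < T, ∀ i < 2 * m + 2, ∀ u : Fin i → galH1Torsion (W.baseChange K) ((2 ^ L : ℕ) : ℤ),
      (∀ k, u k ∈ selmerGroup (W.baseChange K) ((2 ^ L : ℕ) : ℤ) ∧ conjAct W σ ((2 ^ L : ℕ) : ℤ) (u k) = -u k) →
      (∀ k, addOrderOf (u k) = 2 ^ (M (2 * m + 1) - M (2 * m + 2))) →
      ∃ y : galH1Torsion (W.baseChange K) ((2 ^ L : ℕ) : ℤ),
        (y ∈ selmerGroup (W.baseChange K) ((2 ^ L : ℕ) : ℤ) ∧ conjAct W σ ((2 ^ L : ℕ) : ℤ) y = -y) ∧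
        addOrderOf y = 2 ^ (M (2 * m + 1) - M (2 * m + 2)) ∧ Disjoint (zmultiples y) (AddSubgroup.closure (Set.range u))) :
    ∃ (T : ℕ) (M : ℕ → ℕ), (∀ j, M (j + 1) ≤ M j) ∧ M 0 = M₀ ∧ M (2 * T) = 0 ∧
      (∀ m < T, ∃ x : Fin (2 * m + 2) → W.galH1, (∀ i, resBaseChange W K (x i) ∈ (W.baseChange K).sha) ∧
        (∀ i, addOrderOf (x i) = 2 ^ (M (2 * m) - M (2 * m + 1))) ∧
        ∀ c : Fin (2 * m + 2) → ℤ, ∑ i, c i • x i = 0 → ∀ i, ((2 ^ (M (2 * m) - M (2 * m + 1)) : ℕ) : ℤ) ∣ c i) ∧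
      (∀ m < T, ∃ x : Fin (2 * m + 2) → Wd.galH1, (∀ i, resBaseChange Wd K (x i) ∈ (Wd.baseChange K).sha) ∧
        (∀ i, addOrderOf (x i) = 2 ^ (M (2 * m + 1) - M (2 * m + 2))) ∧
        ∀ c : Fin (2 * m + 2) → ℤ, ∑ i, c i • x i = 0 → ∀ i, ((2 ^ (M (2 * m + 1) - M (2 * m + 2)) : ℕ) : ℤ) ∣ c i) := by
  refine ⟨T, M, hM, hM0, hMT, fun m hm ↦ ?_, fun m hm ↦ ?_⟩
  · exact exists_shaFamily_W_of_forall_exists_avoiding_seed W K h2 σ hσ L hdiv hL g hg P₀ hP₀ (s := 2 * m + 2)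
      (a := M (2 * m) - M (2 * m + 1)) (hsup m hm)
  · exact exists_shaFamily_twin_of_forall_exists_avoiding_of_divisible W K h2 σ hσ L hL hWd hdivWd (s := 2 * m + 2)
      (a := M (2 * m + 1) - M (2 * m + 2)) (hsup' m hm)

end Swapped

end Summit.BirchSwinnertonDyer.BirchSwinnertonDyer.Theorems.GenusExact.PlusDescent

end
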